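import Summits.Parity.GeneralizedHardyLittlewood.Theorems.GreenTaoLevelTwoMNTwoVerticalWeights
import Mathlib.Analysis.PSeries
import Mathlib.Analysis.SpecialFunctions.Pow.Real
import HarnessLib

/-!
# Route `GreenTaoLevelTwo`, crux `MNTwo` (stmt-Parity-21276), line `birth`: explicit bounds for
# the squared smoothing weights (the harmonic-analysis core of `stub_verticalReduction`, VI)

The squared one-dimensional smoothing multiplier weight
`w_s(k) = bₛ(k)²`, `bₛ(0) = 1`, `bₛ(k) = min(1, (π |s| |k|)⁻¹)` (`k ≠ 0`), of
`…MNTwoVerticalMultiplier` is dominated by `1_{k=0} + (π² s²)⁻¹ |k|^{-3/2}`; hence, with the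
absolute constant `Z = ∑_{k ∈ ℤ} |k|^{-3/2}` (`Real.summable_abs_int_rpow`),

* symmetric partial sums: `∑_{|k| ≤ K'} w_s(k) ≤ 1 + Z (π² s²)⁻¹` (`sum_Icc_weight_le`);
* partial sums off `[-K, K]`: `∑_{K < |k| ≤ K'} w_s(k) ≤ Z (π² s²)⁻¹ (K+1)^{-1/2}`
  (`sum_sdiff_weight_le`),

the hypotheses `hA`, `hT` of `…MNTwoVerticalWeights` with `A = 1 + Z/(π² s²)` and
`T = Z/(π² s² √(K+1))` — polynomial in `1/s` and decaying in `K`, as the truncation step of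
Green–Tao 2012a Lemma 3.7 needs.

References: B. Green, T. Tao, *The Möbius function is strongly orthogonal to nilsequences*,
Ann. of Math. 175 (2012), Lemma 3.7 and App. A [GreenTao2012Mobius].
-/

noncomputable section

namespace Summit.Parity.GeneralizedHardyLittlewood.GreenTaoLevelTwoMNTwoVerticalWeightsExplicit

/-! ### §1 The dominating family `|k|^{-3/2}` -/

/-- `k ↦ |k|^{-3/2}` is summable over `ℤ`. [folklore] -/
theorem summable_rpow_threeHalves : Summable fun k : ℤ => |(k : ℝ)| ^ (-(3 / 2 : ℝ)) :=
  Real.summable_abs_int_rpow (by norm_num)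

/-- `|k|^{-3/2} ≥ 0`. [folklore] -/
theorem rpow_threeHalves_nonneg (k : ℤ) : 0 ≤ |(k : ℝ)| ^ (-(3 / 2 : ℝ)) :=
  Real.rpow_nonneg (abs_nonneg _) _

/-- Finite sums of `|k|^{-3/2}` are bounded by the full sum `Z`. [folklore] -/
theorem sum_rpow_le_tsum (S : Finset ℤ) :
    ∑ k ∈ S, |(k : ℝ)| ^ (-(3 / 2 : ℝ)) ≤ ∑' k : ℤ, |(k : ℝ)| ^ (-(3 / 2 : ℝ)) :=
  summable_rpow_threeHalves.sum_le_tsum S fun k _ => rpow_threeHalves_nonneg k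

/-! ### §2 Pointwise domination of the squared weight -/

/-- The squared weight is nonnegative. [folklore] -/
theorem weight_sq_nonneg (r : ℝ) (k : ℤ) :
    0 ≤ (if k = 0 then (1 : ℝ) else min 1 (1 / (Real.pi * |r| * |(k : ℝ)|))) ^ 2 :=
  sq_nonneg _

/-- For `k ≠ 0`: `min(1, (π|r||k|)⁻¹)² ≤ (π² r²)⁻¹ |k|⁻²` and `|k|⁻² = |k|^{-3/2} |k|^{-1/2}`;
here the basic form `min(1,(π|r||k|)⁻¹)² ≤ (π² r²)⁻¹ · |k|^{-3/2} · |k|^{-1/2}`.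
[folklore] -/
theorem min_sq_le {r : ℝ} (hr : r ≠ 0) {k : ℤ} (hk : k ≠ 0) :
    (min 1 (1 / (Real.pi * |r| * |(k : ℝ)|))) ^ 2 ≤
      (1 / (Real.pi ^ 2 * r ^ 2)) * (|(k : ℝ)| ^ (-(3 / 2 : ℝ)) * |(k : ℝ)| ^ (-(1 / 2 : ℝ))) := by
  have hk' : (0 : ℝ) < |(k : ℝ)| := by
    rw [abs_pos]; exact_mod_cast hk
  have hπ := Real.pi_pos
  have hr' : 0 < |r| := abs_pos.mpr hr
  have hpos : 0 < Real.pi * |r| * |(k : ℝ)| := by positivity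
  -- `|k|^{-3/2} |k|^{-1/2} = |k|^{-2} = 1/k²`
  have hk2 : |(k : ℝ)| ^ (-(3 / 2 : ℝ)) * |(k : ℝ)| ^ (-(1 / 2 : ℝ)) = 1 / |(k : ℝ)| ^ 2 := by
    rw [← Real.rpow_add hk', show (-(3 / 2 : ℝ)) + -(1 / 2 : ℝ) = -(2 : ℝ) by norm_num,
      Real.rpow_neg hk'.le, one_div]
    norm_cast
  rw [hk2]
  have hmin : min 1 (1 / (Real.pi * |r| * |(k : ℝ)|)) ≤ 1 / (Real.pi * |r| * |(k : ℝ)|) :=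
    min_le_right _ _
  have hmin0 : 0 ≤ min 1 (1 / (Real.pi * |r| * |(k : ℝ)|)) := le_min zero_le_one (by positivity)
  calc (min 1 (1 / (Real.pi * |r| * |(k : ℝ)|))) ^ 2 ≤ (1 / (Real.pi * |r| * |(k : ℝ)|)) ^ 2 :=
        pow_le_pow_left₀ hmin0 hmin 2
    _ = (1 / (Real.pi ^ 2 * r ^ 2)) * (1 / |(k : ℝ)| ^ 2) := by
        rw [div_pow, mul_pow, mul_pow, sq_abs r]
        field_simp

/-- **Domination**: `w_r(k) ≤ 1_{k=0} + (π² r²)⁻¹ |k|^{-3/2}` for every `k`. [folklore] -/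
theorem weight_sq_le {r : ℝ} (hr : r ≠ 0) (k : ℤ) :
    (if k = 0 then (1 : ℝ) else min 1 (1 / (Real.pi * |r| * |(k : ℝ)|))) ^ 2 ≤
      (if k = 0 then (1 : ℝ) else 0) + (1 / (Real.pi ^ 2 * r ^ 2)) * |(k : ℝ)| ^ (-(3 / 2 : ℝ)) := by
  have hc : 0 ≤ (1 / (Real.pi ^ 2 * r ^ 2)) * |(k : ℝ)| ^ (-(3 / 2 : ℝ)) :=
    mul_nonneg (by positivity) (rpow_threeHalves_nonneg k)
  split_ifs with hk
  · rw [one_pow]; linarith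
  · rw [zero_add]
    refine (min_sq_le hr hk).trans ?_
    have hk' : (1 : ℝ) ≤ |(k : ℝ)| := by
      rw [← Int.cast_abs]; exact_mod_cast Int.one_le_abs hk
    have h1 : |(k : ℝ)| ^ (-(1 / 2 : ℝ)) ≤ 1 :=
      Real.rpow_le_one_of_one_le_of_nonpos hk' (by norm_num)
    calc (1 / (Real.pi ^ 2 * r ^ 2)) * (|(k : ℝ)| ^ (-(3 / 2 : ℝ)) * |(k : ℝ)| ^ (-(1 / 2 : ℝ)))
        ≤ (1 / (Real.pi ^ 2 * r ^ 2)) * (|(k : ℝ)| ^ (-(3 / 2 : ℝ)) * 1) :=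
          mul_le_mul_of_nonneg_left (mul_le_mul_of_nonneg_left h1 (rpow_threeHalves_nonneg k))
            (by positivity)
      _ = _ := by rw [mul_one]

/-- **Domination off `[-K, K]`**: for `|k| > K`,
`w_r(k) ≤ (π² r²)⁻¹ (K+1)^{-1/2} |k|^{-3/2}`. [folklore] -/
theorem weight_sq_le_of_lt {r : ℝ} (hr : r ≠ 0) (K : ℕ) {k : ℤ}
    (hk : k ∉ Finset.Icc (-(K : ℤ)) K) :
    (if k = 0 then (1 : ℝ) else min 1 (1 / (Real.pi * |r| * |(k : ℝ)|))) ^ 2 ≤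
      (1 / (Real.pi ^ 2 * r ^ 2)) * ((K : ℝ) + 1) ^ (-(1 / 2 : ℝ)) * |(k : ℝ)| ^ (-(3 / 2 : ℝ)) := by
  rw [Finset.mem_Icc, not_and_or, not_le, not_le] at hk
  have hk0 : k ≠ 0 := by rintro rfl; omega
  have hkK : (K : ℤ) + 1 ≤ |k| := by
    rcases hk with h | h
    · rw [abs_of_neg (by omega)]; omega
    · rw [abs_of_pos (by omega)]; omega
  have hkK' : ((K : ℝ) + 1) ≤ |(k : ℝ)| := by
    rw [← Int.cast_abs]; exact_mod_cast hkK
  have hK0 : (0 : ℝ) < (K : ℝ) + 1 := by positivity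
  rw [if_neg hk0]
  refine (min_sq_le hr hk0).trans ?_
  have h1 : |(k : ℝ)| ^ (-(1 / 2 : ℝ)) ≤ ((K : ℝ) + 1) ^ (-(1 / 2 : ℝ)) :=
    Real.rpow_le_rpow_of_nonpos hK0 hkK' (by norm_num)
  calc (1 / (Real.pi ^ 2 * r ^ 2)) * (|(k : ℝ)| ^ (-(3 / 2 : ℝ)) * |(k : ℝ)| ^ (-(1 / 2 : ℝ)))
      ≤ (1 / (Real.pi ^ 2 * r ^ 2)) * (|(k : ℝ)| ^ (-(3 / 2 : ℝ)) * ((K : ℝ) + 1) ^ (-(1 / 2 : ℝ))) :=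
        mul_le_mul_of_nonneg_left (mul_le_mul_of_nonneg_left h1 (rpow_threeHalves_nonneg k))
          (by positivity)
    _ = _ := by ring

/-! ### §3 The partial-sum bounds `hA`, `hT` -/

/-- **Symmetric partial sums**: `∑_{|k| ≤ K'} w_r(k) ≤ 1 + Z/(π² r²)`. [folklore] -/
theorem sum_Icc_weight_le {r : ℝ} (hr : r ≠ 0) (K' : ℕ) :
    ∑ k ∈ Finset.Icc (-(K' : ℤ)) K',
        (if k = 0 then (1 : ℝ) else min 1 (1 / (Real.pi * |r| * |(k : ℝ)|))) ^ 2 ≤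
      1 + (1 / (Real.pi ^ 2 * r ^ 2)) * ∑' k : ℤ, |(k : ℝ)| ^ (-(3 / 2 : ℝ)) := by
  set S := Finset.Icc (-(K' : ℤ)) K'
  calc ∑ k ∈ S, (if k = 0 then (1 : ℝ) else min 1 (1 / (Real.pi * |r| * |(k : ℝ)|))) ^ 2
      ≤ ∑ k ∈ S, ((if k = 0 then (1 : ℝ) else 0) + (1 / (Real.pi ^ 2 * r ^ 2)) * |(k : ℝ)| ^ (-(3 / 2 : ℝ))) :=
        Finset.sum_le_sum fun k _ => weight_sq_le hr k
    _ = (∑ k ∈ S, (if k = 0 then (1 : ℝ) else 0)) +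
          (1 / (Real.pi ^ 2 * r ^ 2)) * ∑ k ∈ S, |(k : ℝ)| ^ (-(3 / 2 : ℝ)) := by
        rw [Finset.sum_add_distrib, Finset.mul_sum]
    _ ≤ 1 + (1 / (Real.pi ^ 2 * r ^ 2)) * ∑' k : ℤ, |(k : ℝ)| ^ (-(3 / 2 : ℝ)) := by
        refine add_le_add ?_ (mul_le_mul_of_nonneg_left (sum_rpow_le_tsum S) (by positivity))
        rw [Finset.sum_ite_eq' S (0 : ℤ) (fun _ => (1 : ℝ))]
        split_ifs <;> norm_num

/-- **Partial sums off `[-K, K]`**: `∑_{K < |k| ≤ K'} w_r(k) ≤ Z (π² r²)⁻¹ (K+1)^{-1/2}`.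
[folklore] -/
theorem sum_sdiff_weight_le {r : ℝ} (hr : r ≠ 0) (K K' : ℕ) :
    ∑ k ∈ Finset.Icc (-(K' : ℤ)) K' \ Finset.Icc (-(K : ℤ)) K,
        (if k = 0 then (1 : ℝ) else min 1 (1 / (Real.pi * |r| * |(k : ℝ)|))) ^ 2 ≤
      (1 / (Real.pi ^ 2 * r ^ 2)) * ((K : ℝ) + 1) ^ (-(1 / 2 : ℝ)) *
        ∑' k : ℤ, |(k : ℝ)| ^ (-(3 / 2 : ℝ)) := by
  set S := Finset.Icc (-(K' : ℤ)) K' \ Finset.Icc (-(K : ℤ)) K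
  calc ∑ k ∈ S, (if k = 0 then (1 : ℝ) else min 1 (1 / (Real.pi * |r| * |(k : ℝ)|))) ^ 2
      ≤ ∑ k ∈ S, (1 / (Real.pi ^ 2 * r ^ 2)) * ((K : ℝ) + 1) ^ (-(1 / 2 : ℝ)) * |(k : ℝ)| ^ (-(3 / 2 : ℝ)) :=
        Finset.sum_le_sum fun k hk => weight_sq_le_of_lt hr K (Finset.mem_sdiff.mp hk).2
    _ = (1 / (Real.pi ^ 2 * r ^ 2)) * ((K : ℝ) + 1) ^ (-(1 / 2 : ℝ)) *
          ∑ k ∈ S, |(k : ℝ)| ^ (-(3 / 2 : ℝ)) := by rw [Finset.mul_sum]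
    _ ≤ _ := mul_le_mul_of_nonneg_left (sum_rpow_le_tsum S)
          (mul_nonneg (by positivity) (Real.rpow_nonneg (by positivity) _))

end Summit.Parity.GeneralizedHardyLittlewood.GreenTaoLevelTwoMNTwoVerticalWeightsExplicit
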